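import Summits.NavierStokesRegularity.NavierStokesRegularity.Theorems.AxisTwistDoorAveragedConeLiouvilleNUWeakEnergyPointwise
import HarnessLib

/-!
# N4 / T1 piece W, brick W0: the time cut-off `ψ(t)V` of a Lipschitz generalized supersolution is again
# one (weak clause VERBATIM), for `ψ ∈ C¹` Lipschitz, `0 ≤ ψ ≤ 1`, `ψ′ ≥ 0`, `ψ = 1` on `[t_b,∞[`

Route `AxisTwistDoor`, crux `AveragedConeLiouville` (stmt-NavierStokesRegularity-26889), INPUT N4 / T1,
programme `kits/N4-T1-skeleton.lean` (118454bf17607d1e), piece W (owner ns-in-ser-c g2, design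
pub/ns-inputs/STATUS 2026-08-28T14:02:53Z: «W1 is applied to the pair (ψV, b) itself»), brick W0 offered
by ns-in-ser-b g2 (STATUS 14:16Z): `weak_clause_time_cutoff` — for the typed weak data (`V` Lipschitz and
nonnegative on `W = ]0,T[ × B(0,1)`, the integral supersolution inequality against nonnegative Lipschitz
tests vanishing near `‖x‖ ≥ ρ` and `t ≤ τ`) the pair `(ψV, b)` has the same three properties, so that W1
(`nu_weakEnergyIdentity`, p640099) applies to it by name. Ingredients: the test `ψη` is admissible
(`ψη = η + (ψ−1)η`, the second factor vanishing for `t ≥ t_b` where `η` is bounded —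
`lipschitzWith_mul_of_eq_zero_off`), the Rademacher slices of `V` (`slice_derivs_at`), the product rule
in `t`, `∇ₓ(ψ(t)f) = ψ(t)∇ₓf` for every `f` (`gradient_const_mul`, no differentiability needed), and
`ψ′Vη ≥ 0`; non-integrable cases are handled by `integral_undef`.

WHAT THIS IS NOT: not a statement about Navier–Stokes; T1 is an INPUT; the summit stays open. [folklore]
-/

noncomputable section

-- the summit and its single sub-problem share the name (CONVENTIONS §1)
set_option linter.dupNamespace false

open MeasureTheory Set Function Filter Topology Metric
open scoped NNReal ENNReal InnerProductSpace RealInnerProductSpace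

namespace Summit.NavierStokesRegularity.NavierStokesRegularity.Theorems.AveragedConeLiouville.NUPositivity

/-- `∇(c·f)(x) = c·∇f(x)` for EVERY `f` (both sides vanish where `f` is not differentiable and `c ≠ 0`).
[folklore] -/
theorem gradient_const_mul (c : ℝ) (f : EuclideanSpace ℝ (Fin 3) → ℝ) (x : EuclideanSpace ℝ (Fin 3)) :
    gradient (fun y => c * f y) x = c • gradient f x := by
  have h := congrFun (fderiv_const_smul_field (𝕜 := ℝ) (f := f) c) x
  have e : (c • f) = fun y => c * f y := by funext y; simp [smul_eq_mul]
  rw [e] at h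
  rw [gradient, gradient, h, Pi.smul_apply, LinearIsometryEquiv.map_smul]

/-- **`ψ(t)V` is Lipschitz on the cylinder** for `V` Lipschitz there and `ψ` Lipschitz with `|ψ| ≤ 1`.
[folklore] -/
theorem lipschitzOnWith_time_cutoff {T : ℝ} {V : ℝ → EuclideanSpace ℝ (Fin 3) → ℝ}
    (hVlip : ∃ L, LipschitzOnWith L (uncurry V) (Ioo 0 T ×ˢ ball (0 : EuclideanSpace ℝ (Fin 3)) 1))
    {ψ : ℝ → ℝ} {Kψ : ℝ≥0} (hψL : LipschitzWith Kψ ψ) (hψb : ∀ t, |ψ t| ≤ 1) :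
    ∃ L', LipschitzOnWith L' (uncurry fun t x => ψ t * V t x)
      (Ioo 0 T ×ˢ ball (0 : EuclideanSpace ℝ (Fin 3)) 1) := by
  set W : Set (ℝ × EuclideanSpace ℝ (Fin 3)) := Ioo 0 T ×ˢ ball (0 : EuclideanSpace ℝ (Fin 3)) 1 with hW
  obtain ⟨L, hL⟩ := hVlip
  obtain ⟨g, hg, hVg⟩ := hL.extend_real
  have hWc : IsCompact (Icc 0 T ×ˢ closedBall (0 : EuclideanSpace ℝ (Fin 3)) 1) :=
    isCompact_Icc.prod (isCompact_closedBall _ _)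
  have hWsub : W ⊆ Icc 0 T ×ˢ closedBall (0 : EuclideanSpace ℝ (Fin 3)) 1 :=
    Set.prod_mono Ioo_subset_Icc_self ball_subset_closedBall
  obtain ⟨Mg, hMg⟩ := hWc.exists_bound_of_continuousOn hg.continuous.continuousOn
  have hM0 : 0 ≤ max Mg 0 := le_max_right _ _
  set M : ℝ≥0 := ⟨max Mg 0, hM0⟩ with hMdef
  have hM : (M : ℝ) = max Mg 0 := rfl
  refine ⟨L + M * Kψ, lipschitzOnWith_iff_dist_le_mul.2 fun p hp q hq => ?_⟩
  have hVp : V p.1 p.2 = g p := hVg hp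
  have hVq : V q.1 q.2 = g q := hVg hq
  simp only [uncurry, Real.dist_eq]
  rw [hVp, hVq]
  have h1 : |g p - g q| ≤ L * dist p q := by rw [← Real.dist_eq]; exact hg.dist_le_mul p q
  have h2 : |ψ p.1 - ψ q.1| ≤ Kψ * dist p q := by
    rw [← Real.dist_eq]
    exact (hψL.dist_le_mul p.1 q.1).trans (mul_le_mul_of_nonneg_left
      (by rw [Prod.dist_eq]; exact le_max_left _ _) Kψ.coe_nonneg)
  have h3 : |g q| ≤ max Mg 0 := ((Real.norm_eq_abs _).symm.le.trans (hMg q (hWsub hq))).trans (le_max_left _ _)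
  have e : ψ p.1 * g p - ψ q.1 * g q = ψ p.1 * (g p - g q) + g q * (ψ p.1 - ψ q.1) := by ring
  rw [e]
  calc |ψ p.1 * (g p - g q) + g q * (ψ p.1 - ψ q.1)|
      ≤ |ψ p.1| * |g p - g q| + |g q| * |ψ p.1 - ψ q.1| := by
        refine (abs_add_le _ _).trans ?_; rw [abs_mul, abs_mul]
    _ ≤ 1 * (L * dist p q) + max Mg 0 * (Kψ * dist p q) := by
        gcongr
        · exact hψb p.1
    _ = ↑(L + M * Kψ) * dist p q := by
        rw [NNReal.coe_add, NNReal.coe_mul, hM]; ring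

/-- **The test `ψ(t)η(t,x)` is admissible** (globally Lipschitz) for an admissible `η` and `ψ`
Lipschitz with `0 ≤ ψ ≤ 1`, `ψ = 1` on `[t_b, ∞[`. [folklore] -/
theorem exists_lipschitzWith_time_cutoff_test {η : ℝ → EuclideanSpace ℝ (Fin 3) → ℝ} {K : ℝ≥0}
    (hη : LipschitzWith K (uncurry η)) {τ : ℝ} (hητ : ∀ t x, t ≤ τ → η t x = 0)
    {ψ : ℝ → ℝ} {Kψ : ℝ≥0} (hψL : LipschitzWith Kψ ψ) (hψ01 : ∀ t, 0 ≤ ψ t ∧ ψ t ≤ 1)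
    {tb : ℝ} (hψ1 : ∀ t, tb ≤ t → ψ t = 1) :
    ∃ K', LipschitzWith K' (uncurry fun t x => ψ t * η t x) := by
  -- `ψη = η + (ψ - 1)η`, the second factor vanishing off `S = {t ≤ tb}` where `η` is bounded
  set S : Set (ℝ × EuclideanSpace ℝ (Fin 3)) := {p | p.1 ≤ tb} with hS
  have hG : LipschitzWith Kψ fun p : ℝ × EuclideanSpace ℝ (Fin 3) => ψ p.1 - 1 := by
    refine LipschitzWith.of_dist_le_mul fun p q => ?_
    rw [Real.dist_eq, show ψ p.1 - 1 - (ψ q.1 - 1) = ψ p.1 - ψ q.1 by ring, ← Real.dist_eq]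
    exact (hψL.dist_le_mul _ _).trans (mul_le_mul_of_nonneg_left
      (by rw [Prod.dist_eq]; exact le_max_left _ _) Kψ.coe_nonneg)
  have hGb : ∀ p : ℝ × EuclideanSpace ℝ (Fin 3), |ψ p.1 - 1| ≤ 1 := fun p => by
    rw [abs_sub_comm, abs_of_nonneg (by linarith [(hψ01 p.1).2])]; linarith [(hψ01 p.1).1]
  have hG0 : ∀ p : ℝ × EuclideanSpace ℝ (Fin 3), p ∉ S → ψ p.1 - 1 = 0 := fun p hp => by
    rw [hψ1 p.1 (le_of_lt (not_le.mp hp)), sub_self]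
  have hM0 : 0 ≤ (K : ℝ) * max (tb - τ) 0 := mul_nonneg K.coe_nonneg (le_max_right _ _)
  have hFb : ∀ p ∈ S, |uncurry η p| ≤ K * max (tb - τ) 0 := by
    intro p hp
    by_cases hpt : p.1 ≤ τ
    · simp only [uncurry, hητ p.1 p.2 hpt, abs_zero]; exact hM0
    · have h0 : uncurry η (τ, p.2) = 0 := hητ τ p.2 le_rfl
      have h1 := hη.dist_le_mul p (τ, p.2)
      rw [Real.dist_eq, h0, sub_zero] at h1
      refine h1.trans (mul_le_mul_of_nonneg_left ?_ K.coe_nonneg)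
      have hd : dist p (τ, p.2) = dist p.1 τ := by
        rw [Prod.dist_eq, dist_self]; exact max_eq_left dist_nonneg
      rw [hd, Real.dist_eq, abs_of_nonneg (by linarith [not_le.mp hpt])]
      exact le_trans (by linarith [show p.1 ≤ tb from hp]) (le_max_left _ _)
  have hprod := lipschitzWith_mul_of_eq_zero_off hG hGb hG0 (hη.lipschitzOnWith (s := S)) hFb hM0 zero_le_one
  have e : (uncurry fun t x => ψ t * η t x) =
      fun p => uncurry η p + uncurry η p * (ψ p.1 - 1) := by
    funext p; simp only [uncurry]; ring
  rw [e]
  exact ⟨_, hη.add hprod⟩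

/-- **W0: the time cut-off `ψ(t)V` of a Lipschitz generalized supersolution is again one** (module
docstring): Lipschitz on the cylinder, nonnegative there, and the weak supersolution clause VERBATIM for
the pair `(fun t x => ψ t * V t x, b)`. [folklore] -/
theorem weak_clause_time_cutoff {T : ℝ} {V : ℝ → EuclideanSpace ℝ (Fin 3) → ℝ}
    {b : ℝ → EuclideanSpace ℝ (Fin 3) → EuclideanSpace ℝ (Fin 3)}
    (hVlip : ∃ L, LipschitzOnWith L (uncurry V) (Ioo 0 T ×ˢ ball (0 : EuclideanSpace ℝ (Fin 3)) 1))
    (hV0 : ∀ t ∈ Ioo 0 T, ∀ x ∈ ball (0 : EuclideanSpace ℝ (Fin 3)) 1, 0 ≤ V t x)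
    (hweak : ∀ η : ℝ → EuclideanSpace ℝ (Fin 3) → ℝ, (∃ K, LipschitzWith K (uncurry η)) →
        (∀ t x, 0 ≤ η t x) →
        (∃ ρ τ : ℝ, ρ < 1 ∧ 0 < τ ∧ ∀ t x, (ρ ≤ ‖x‖ ∨ t ≤ τ) → η t x = 0) →
        0 ≤ ∫ p in Ioo 0 T ×ˢ ball (0 : EuclideanSpace ℝ (Fin 3)) 1,
          (deriv (fun s => V s p.2) p.1 * η p.1 p.2 +
            ⟪gradient (V p.1) p.2, gradient (η p.1) p.2⟫ +
            ⟪b p.1 p.2, gradient (V p.1) p.2⟫ * η p.1 p.2))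
    {ψ : ℝ → ℝ} (hψ : ContDiff ℝ 1 ψ) (hψ01 : ∀ t, 0 ≤ ψ t ∧ ψ t ≤ 1) (hψ' : ∀ t, 0 ≤ deriv ψ t)
    {Kψ : ℝ≥0} (hψL : LipschitzWith Kψ ψ) {tb : ℝ} (hψ1 : ∀ t, tb ≤ t → ψ t = 1) :
    (∃ L', LipschitzOnWith L' (uncurry fun t x => ψ t * V t x)
        (Ioo 0 T ×ˢ ball (0 : EuclideanSpace ℝ (Fin 3)) 1)) ∧
      (∀ t ∈ Ioo 0 T, ∀ x ∈ ball (0 : EuclideanSpace ℝ (Fin 3)) 1, 0 ≤ ψ t * V t x) ∧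
      (∀ η : ℝ → EuclideanSpace ℝ (Fin 3) → ℝ, (∃ K, LipschitzWith K (uncurry η)) →
        (∀ t x, 0 ≤ η t x) →
        (∃ ρ τ : ℝ, ρ < 1 ∧ 0 < τ ∧ ∀ t x, (ρ ≤ ‖x‖ ∨ t ≤ τ) → η t x = 0) →
        0 ≤ ∫ p in Ioo 0 T ×ˢ ball (0 : EuclideanSpace ℝ (Fin 3)) 1,
          (deriv (fun s => ψ s * V s p.2) p.1 * η p.1 p.2 +
            ⟪gradient (fun x => ψ p.1 * V p.1 x) p.2, gradient (η p.1) p.2⟫ +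
            ⟪b p.1 p.2, gradient (fun x => ψ p.1 * V p.1 x) p.2⟫ * η p.1 p.2)) := by
  have hψb : ∀ t, |ψ t| ≤ 1 := fun t => by rw [abs_of_nonneg (hψ01 t).1]; exact (hψ01 t).2
  refine ⟨lipschitzOnWith_time_cutoff hVlip hψL hψb,
    fun t ht x hx => mul_nonneg (hψ01 t).1 (hV0 t ht x hx), fun η hηK hη0 hηvan => ?_⟩
  obtain ⟨K, hK⟩ := hηK
  obtain ⟨ρ, τ, hρ, hτ, hvan⟩ := hηvan
  -- the cylinder, the extension, Rademacher
  set W : Set (ℝ × EuclideanSpace ℝ (Fin 3)) := Ioo 0 T ×ˢ ball (0 : EuclideanSpace ℝ (Fin 3)) 1 with hW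
  have hWopen : IsOpen W := isOpen_Ioo.prod isOpen_ball
  have hWm : MeasurableSet W := hWopen.measurableSet
  have hWc : IsCompact (Icc 0 T ×ˢ closedBall (0 : EuclideanSpace ℝ (Fin 3)) 1) :=
    isCompact_Icc.prod (isCompact_closedBall _ _)
  have hWsub : W ⊆ Icc 0 T ×ˢ closedBall (0 : EuclideanSpace ℝ (Fin 3)) 1 :=
    Set.prod_mono Ioo_subset_Icc_self ball_subset_closedBall
  have hWfin : volume W < ∞ := (measure_mono hWsub).trans_lt hWc.measure_lt_top
  obtain ⟨L, hL⟩ := hVlip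
  obtain ⟨g, hg, hVg⟩ := hL.extend_real
  haveI : (volume : Measure (ℝ × EuclideanSpace ℝ (Fin 3))).IsAddHaarMeasure := by
    change ((volume : Measure ℝ).prod (volume : Measure (EuclideanSpace ℝ (Fin 3)))).IsAddHaarMeasure
    infer_instance
  have hae : ∀ᵐ p ∂(volume.restrict W), p ∈ W ∧ DifferentiableAt ℝ g p :=
    (ae_restrict_mem hWm).and (ae_restrict_of_ae (hg.ae_differentiableAt (μ := volume)))
  -- the admissible test `ψη` and the weak inequality for it
  have hητ : ∀ t x, t ≤ τ → η t x = 0 := fun t x ht => hvan t x (Or.inr ht)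
  obtain ⟨K', hK'⟩ := exists_lipschitzWith_time_cutoff_test hK hητ hψL hψ01 hψ1
  have hw := hweak (fun t x => ψ t * η t x) ⟨K', hK'⟩ (fun t x => mul_nonneg (hψ01 t).1 (hη0 t x))
    ⟨ρ, τ, hρ, hτ, fun t x h => by rw [hvan t x h, mul_zero]⟩
  -- the two integrands and the correction `ψ′Vη`
  set G : ℝ × EuclideanSpace ℝ (Fin 3) → ℝ := fun p =>
    deriv (fun s => ψ s * V s p.2) p.1 * η p.1 p.2 +
      ⟪gradient (fun x => ψ p.1 * V p.1 x) p.2, gradient (η p.1) p.2⟫ +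
      ⟪b p.1 p.2, gradient (fun x => ψ p.1 * V p.1 x) p.2⟫ * η p.1 p.2 with hGdef
  set Wt : ℝ × EuclideanSpace ℝ (Fin 3) → ℝ := fun p =>
    deriv (fun s => V s p.2) p.1 * (ψ p.1 * η p.1 p.2) +
      ⟪gradient (V p.1) p.2, gradient (fun x => ψ p.1 * η p.1 x) p.2⟫ +
      ⟪b p.1 p.2, gradient (V p.1) p.2⟫ * (ψ p.1 * η p.1 p.2) with hWt
  set P : ℝ × EuclideanSpace ℝ (Fin 3) → ℝ := fun p => deriv ψ p.1 * V p.1 p.2 * η p.1 p.2 with hP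
  have hGae : G =ᵐ[volume.restrict W] fun p => Wt p + P p := by
    filter_upwards [hae] with p hp
    obtain ⟨-, -, -, -, -, h6⟩ := slice_derivs_at hWopen hg hVg hp.1 hp.2
    have hψd : HasDerivAt ψ (deriv ψ p.1) p.1 := ((hψ.differentiable one_ne_zero) p.1).hasDerivAt
    have h' : HasDerivAt (fun s => ψ s * V s p.2)
        (deriv ψ p.1 * V p.1 p.2 + ψ p.1 * fderiv ℝ g p ((1 : ℝ), (0 : EuclideanSpace ℝ (Fin 3)))) p.1 :=
      hψd.mul h6
    have hd : deriv (fun s => ψ s * V s p.2) p.1 =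
        deriv ψ p.1 * V p.1 p.2 + ψ p.1 * deriv (fun s => V s p.2) p.1 := by
      rw [h'.deriv, h6.deriv]
    simp only [hGdef, hWt, hP]
    rw [hd, gradient_const_mul, gradient_const_mul, inner_smul_left, inner_smul_right, inner_smul_right]
    simp only [RCLike.conj_to_real]
    ring
  -- `P` is integrable on the cylinder (bounded and continuous there) and nonnegative
  obtain ⟨Mg, hMg⟩ := hWc.exists_bound_of_continuousOn hg.continuous.continuousOn
  obtain ⟨Mη, hMη⟩ := hWc.exists_bound_of_continuousOn hK.continuous.continuousOn
  obtain ⟨Mψ, hMψ⟩ := isCompact_Icc.exists_bound_of_continuousOn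
    ((hψ.continuous_deriv le_rfl).continuousOn (s := Icc 0 T))
  have hPm : AEStronglyMeasurable P (volume.restrict W) := by
    have hc : ContinuousOn P W :=
      ((((hψ.continuous_deriv le_rfl).comp continuous_fst).continuousOn).mul hL.continuousOn).mul
        hK.continuous.continuousOn
    exact hc.aestronglyMeasurable hWm
  have hPi : Integrable P (volume.restrict W) := by
    refine Integrable.mono' (integrableOn_const hWfin.ne (C := Mψ * Mg * Mη)) hPm ?_
    filter_upwards [ae_restrict_mem hWm] with p hp
    have hVgp : V p.1 p.2 = g p := hVg hp
    simp only [hP]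
    rw [norm_mul, norm_mul, hVgp]
    have h1 := hMψ p.1 (Ioo_subset_Icc_self hp.1)
    have h2 := hMg p (hWsub hp)
    have h3 := hMη p (hWsub hp)
    have h0 : 0 ≤ Mψ := (norm_nonneg _).trans h1
    have h0' : 0 ≤ Mg := (norm_nonneg _).trans h2
    exact mul_le_mul (mul_le_mul h1 h2 (norm_nonneg _) h0) h3 (norm_nonneg _) (mul_nonneg h0 h0')
  have hP0 : ∀ p ∈ W, 0 ≤ P p := fun p hp =>
    mul_nonneg (mul_nonneg (hψ' p.1) (hV0 p.1 hp.1 p.2 hp.2)) (hη0 p.1 p.2)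
  have hPint : 0 ≤ ∫ p in W, P p := setIntegral_nonneg hWm hP0
  -- split according to the integrability of the tested integrand
  change 0 ≤ ∫ p in W, G p
  rw [integral_congr_ae hGae]
  by_cases hWi : Integrable Wt (volume.restrict W)
  · rw [integral_add hWi hPi]
    exact add_nonneg hw hPint
  · have hnot : ¬ Integrable (fun p => Wt p + P p) (volume.restrict W) := fun h =>
      hWi ((h.sub hPi).congr (Eventually.of_forall fun p => by simp))
    rw [integral_undef hnot]

/-- **A `C¹` plateau is Lipschitz:** `ψ ∈ C¹` with `ψ = 0` on `]−∞,t_a]` and `ψ = 1` on `[t_b,∞[`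
has a bounded derivative. [folklore] -/
theorem exists_lipschitzWith_plateau {ψ : ℝ → ℝ} (hψ : ContDiff ℝ 1 ψ) {ta tb : ℝ}
    (hψ0 : ∀ t, t ≤ ta → ψ t = 0) (hψ1 : ∀ t, tb ≤ t → ψ t = 1) :
    ∃ Kψ : ℝ≥0, LipschitzWith Kψ ψ := by
  obtain ⟨C₀, hC₀⟩ := isCompact_Icc.exists_bound_of_continuousOn
    ((hψ.continuous_deriv le_rfl).continuousOn (s := Icc ta tb))
  have hC : 0 ≤ max C₀ 0 := le_max_right _ _
  refine ⟨Real.toNNReal (max C₀ 0),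
    lipschitzWith_of_nnnorm_deriv_le (hψ.differentiable one_ne_zero) fun t => ?_⟩
  rw [← NNReal.coe_le_coe, coe_nnnorm, Real.coe_toNNReal _ hC]
  by_cases ht : t ∈ Icc ta tb
  · exact (hC₀ t ht).trans (le_max_left _ _)
  · have hd : deriv ψ t = 0 := by
      rcases not_and_or.mp (show ¬ (ta ≤ t ∧ t ≤ tb) from ht) with h | h
      · have hlt : t < ta := not_le.mp h
        have hev : ψ =ᶠ[𝓝 t] fun _ => (0 : ℝ) := by
          filter_upwards [Iio_mem_nhds hlt] with s hs using hψ0 s (le_of_lt hs)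
        rw [hev.deriv_eq, deriv_const]
      · have hlt : tb < t := not_le.mp h
        have hev : ψ =ᶠ[𝓝 t] fun _ => (1 : ℝ) := by
          filter_upwards [Ioi_mem_nhds hlt] with s hs using hψ1 s (le_of_lt hs)
        rw [hev.deriv_eq, deriv_const]
    rw [hd, norm_zero]; exact hC

/-- **W0 for a `C¹` plateau `ψ`** (`ψ = 0` on `]−∞,t_a]`, `ψ = 1` on `[t_b,∞[`, `0 ≤ ψ ≤ 1`, `ψ′ ≥ 0` —
e.g. the `Real.smoothTransition` cut-offs of `timeCutoff_props`): the conclusions of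
`weak_clause_time_cutoff` without a Lipschitz hypothesis. [folklore] -/
theorem weak_clause_time_cutoff' {T : ℝ} {V : ℝ → EuclideanSpace ℝ (Fin 3) → ℝ}
    {b : ℝ → EuclideanSpace ℝ (Fin 3) → EuclideanSpace ℝ (Fin 3)}
    (hVlip : ∃ L, LipschitzOnWith L (uncurry V) (Ioo 0 T ×ˢ ball (0 : EuclideanSpace ℝ (Fin 3)) 1))
    (hV0 : ∀ t ∈ Ioo 0 T, ∀ x ∈ ball (0 : EuclideanSpace ℝ (Fin 3)) 1, 0 ≤ V t x)
    (hweak : ∀ η : ℝ → EuclideanSpace ℝ (Fin 3) → ℝ, (∃ K, LipschitzWith K (uncurry η)) →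
        (∀ t x, 0 ≤ η t x) →
        (∃ ρ τ : ℝ, ρ < 1 ∧ 0 < τ ∧ ∀ t x, (ρ ≤ ‖x‖ ∨ t ≤ τ) → η t x = 0) →
        0 ≤ ∫ p in Ioo 0 T ×ˢ ball (0 : EuclideanSpace ℝ (Fin 3)) 1,
          (deriv (fun s => V s p.2) p.1 * η p.1 p.2 +
            ⟪gradient (V p.1) p.2, gradient (η p.1) p.2⟫ +
            ⟪b p.1 p.2, gradient (V p.1) p.2⟫ * η p.1 p.2))
    {ψ : ℝ → ℝ} (hψ : ContDiff ℝ 1 ψ) (hψ01 : ∀ t, 0 ≤ ψ t ∧ ψ t ≤ 1) (hψ' : ∀ t, 0 ≤ deriv ψ t)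
    {ta tb : ℝ} (hψ0 : ∀ t, t ≤ ta → ψ t = 0) (hψ1 : ∀ t, tb ≤ t → ψ t = 1) :
    (∃ L', LipschitzOnWith L' (uncurry fun t x => ψ t * V t x)
        (Ioo 0 T ×ˢ ball (0 : EuclideanSpace ℝ (Fin 3)) 1)) ∧
      (∀ t ∈ Ioo 0 T, ∀ x ∈ ball (0 : EuclideanSpace ℝ (Fin 3)) 1, 0 ≤ ψ t * V t x) ∧
      (∀ η : ℝ → EuclideanSpace ℝ (Fin 3) → ℝ, (∃ K, LipschitzWith K (uncurry η)) →
        (∀ t x, 0 ≤ η t x) →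
        (∃ ρ τ : ℝ, ρ < 1 ∧ 0 < τ ∧ ∀ t x, (ρ ≤ ‖x‖ ∨ t ≤ τ) → η t x = 0) →
        0 ≤ ∫ p in Ioo 0 T ×ˢ ball (0 : EuclideanSpace ℝ (Fin 3)) 1,
          (deriv (fun s => ψ s * V s p.2) p.1 * η p.1 p.2 +
            ⟪gradient (fun x => ψ p.1 * V p.1 x) p.2, gradient (η p.1) p.2⟫ +
            ⟪b p.1 p.2, gradient (fun x => ψ p.1 * V p.1 x) p.2⟫ * η p.1 p.2)) := by
  obtain ⟨Kψ, hψL⟩ := exists_lipschitzWith_plateau hψ hψ0 hψ1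
  exact weak_clause_time_cutoff hVlip hV0 hweak hψ hψ01 hψ' hψL hψ1

end Summit.NavierStokesRegularity.NavierStokesRegularity.Theorems.AveragedConeLiouville.NUPositivity

end
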